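import Literature.MathematicalPhysics.QuantumFieldTheory.Balaban1983to89.B1Eq324BenfattoSect5Eq524
import HarnessLib

/-!
# `Balaban1983to89.B1Eq324BenfattoSect5SlotMasses` — [BenfattoEtAl1978] §5 (5.29) p. 158, the size `s₂b^{D+2d}A` of print's slots:
# the COEFFICIENT MASSES `𝓜 = Σ|A^n_Δ|e^{−(ϰ/2)d(Δ)}` (and their weighted forms) of a tuple class whose tuples lie in a region `R`
# are `≤ A·|R|·(constant of s, D, d, rate)` — the lattice-sum engine `B1Eq324BenfattoSect5Eq524.sum_exp_anchored_le` BY NAME — PROVED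

statement-level skeleton of published theorems with citation tags; proofs where landed; nothing here is a claim about the
Yang–Mills mass gap

WHY THIS MODULE (cell `pub-ymgap`, seat `dag-n08-c`, node N08).  The polynomial-slot theorems of this seat's lane
(`…Sect5SlotMoments` §4, `…Sect5TupleClusters` §2–§3) and the per-box relation on print's objects (`…Sect5PerBoxOnData`, n08-b)
carry the slots through their coefficient masses `𝓜_j = Σ_{p}Σ_{Δ∈T_j p}Σ_n |A^n_Δ|e^{−(ϰ/2)d(Δ)}` and
`𝓜̃_j = Σ … e^{(δ/2)D²(√d·d(Δ)+d)}` as displayed numbers `≤ M`.  Print's (5.29) has the slot size `s₂b^{D+2d}A` — `A` times the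
volume `b^{2d}` of a tessera-box times a constant: the coefficient decay `e^{−(ϰ/2)d(Δ)}` makes the sum over the tuples anchored in a
region `R` cost `|R|` (the «|I|»-mechanism of (5.11)/(5.24), n08-d's `…Sect5Eq511.sum_exp_neg_mul_connLength_le` /
`…Sect5Eq524.sum_exp_anchored_le`).  This file states that bound z-free, for the masses themselves.

WHAT IS PROVED (theorems only; no definition, no named fact, no `sorry`; axioms standard).
* ★ `classSum_le_card_mul` — THE GENERIC MASS BOUND: for a tuple class `cls p ⊆ (Fin p → J)` all of whose tuples lie in `R` and a
  summand `w(p,Δ,n) ≤ A'·e^{−c·d(Δ)}` (`c > 0`, `A' ≥ 0`),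
  `Σ_{p∈Icc 1 s}Σ_{Δ∈cls p}Σ_{n∈admissible p D} w ≤ A'·|R|·Σ_{p∈Icc 1 s} |admissible p D|·K(c/p, d)^{p−1}`,
  `K(c', d) = (2/(1−e^{−c'/√d})·e^{c'/√d})^d` (anchor at `Δ₀ ∈ R`, `sum_exp_anchored_le` + `card_filter_coe_mem_le`).
* ★ `mass_le_card_mul` — `𝓜 ≤ A·|R|·Σ_p |admissible p D|·K(ϰ/(2p), d)^{p−1}` for `|A^n_Δ| ≤ A` on the range of (4.5) (n08-d's
  convention `hA`).
* ★ `weightedMass_le_card_mul` — `𝓜̃ ≤ A·e^{(δ/2)D²d}·|R|·Σ_p |admissible p D|·K((ϰ − δD²√d)/(2p), d)^{p−1}` at the residual rate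
  `ϰ/2 − (δ/2)D²√d > 0` (print's `ϰ̃ < ϰ`).

HONEST SCOPE / NOT HERE.  Counting only; `|R| ≤ L^d` for `R ⊆ □` (`…Sect5Eq524.card_shrink_le`) and the choice of the classes are the
consumer's; `BasicLemmaPrinted` stays OPEN.  NOT summit progress; count-neutral for N08; nothing of [Balaban1985UV3] is asserted.
-/

open Finset
open scoped BigOperators

namespace Literature.MathematicalPhysics.QuantumFieldTheory.Balaban1983to89.B1Eq324BenfattoSect5SlotMasses

open Literature.MathematicalPhysics.QuantumFieldTheory.Balaban1983to89.B1Eq324BenfattoLemma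
open Literature.MathematicalPhysics.QuantumFieldTheory.Balaban1983to89.B1Eq324BenfattoConnLength (connLength_nonneg)
open Literature.MathematicalPhysics.QuantumFieldTheory.Balaban1983to89.B1Eq324BenfattoSect5Eq524
  (sum_exp_anchored_le card_filter_coe_mem_le)

variable {d : ℕ} {s D : ℕ} {ϰ : ℝ} {a : Coef d} {Jr : Finset (B1Eq324BenfattoLemma.Site d)}

/-- **THE GENERIC MASS BOUND**: a class of tuples of `J` all lying in the region `R`, a summand dominated by `A'·e^{−c·d(Δ)}` (`c > 0`,
`A' ≥ 0`): `Σ_{p∈Icc 1 s}Σ_{Δ∈cls p}Σ_{n∈admissible p D} w(p,Δ,n) ≤ A'·|R|·Σ_{p∈Icc 1 s}|admissible p D|·K(c/p,d)^{p−1}` — anchor every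
tuple at its first tessera `Δ₀ ∈ R` and sum the others freely (`…Sect5Eq524.sum_exp_anchored_le`). [cite: BenfattoEtAl1978, (5.24) p.157 and (5.29) p.158] -/
theorem classSum_le_card_mul {c A' : ℝ} (hc : 0 < c) (hA' : 0 ≤ A') (cls : (p : ℕ) → Finset (Fin p → Jr))
    (R : Finset (B1Eq324BenfattoLemma.Site d))
    (hin : ∀ p ∈ Finset.Icc 1 s, ∀ Δ ∈ cls p, ∀ i, ((Δ i : Jr) : B1Eq324BenfattoLemma.Site d) ∈ R)
    (w : (p : ℕ) → (Fin p → Jr) → (Fin p → ℕ) → ℝ)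
    (hw : ∀ p ∈ Finset.Icc 1 s, ∀ Δ ∈ cls p, ∀ n ∈ admissible p D,
      w p Δ n ≤ A' * Real.exp (-(c * connLength fun i => (Δ i : B1Eq324BenfattoLemma.Site d)))) :
    ∑ p ∈ Finset.Icc 1 s, ∑ Δ ∈ cls p, ∑ n ∈ admissible p D, w p Δ n ≤
      A' * R.card * ∑ p ∈ Finset.Icc 1 s, ((admissible p D).card : ℝ) *
        ((2 / (1 - Real.exp (-(c / (p : ℕ) / Real.sqrt d))) * Real.exp (c / (p : ℕ) / Real.sqrt d)) ^ d) ^ (p - 1) := by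
  classical
  rw [Finset.mul_sum]
  refine Finset.sum_le_sum fun p hp => ?_
  have hp1 : 1 ≤ p := (Finset.mem_Icc.1 hp).1
  obtain ⟨p', rfl⟩ := Nat.exists_eq_succ_of_ne_zero (Nat.one_le_iff_ne_zero.1 hp1)
  simp only [Nat.succ_eq_add_one, Nat.add_sub_cancel]
  set K : ℝ := ((2 / (1 - Real.exp (-(c / ((p' + 1 : ℕ) : ℝ) / Real.sqrt d))) *
    Real.exp (c / ((p' + 1 : ℕ) : ℝ) / Real.sqrt d)) ^ d) with hK
  -- per tuple: the `n`-sum is at most `|admissible|·A'·e^{−c d(Δ)}`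
  have h1 : ∑ Δ ∈ cls (p' + 1), ∑ n ∈ admissible (p' + 1) D, w (p' + 1) Δ n ≤
      ∑ Δ ∈ cls (p' + 1), ((admissible (p' + 1) D).card : ℝ) *
        (A' * Real.exp (-(c * connLength fun i => (Δ i : B1Eq324BenfattoLemma.Site d)))) := by
    refine Finset.sum_le_sum fun Δ hΔ => ?_
    refine (Finset.sum_le_card_nsmul _ _ _ fun n hn => hw _ hp Δ hΔ n hn).trans ?_
    rw [nsmul_eq_mul]
  -- the class sits inside the tuples anchored in `R`
  have hsub : cls (p' + 1) ⊆ (Finset.univ : Finset (Fin (p' + 1) → Jr)).filter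
      (fun Δ => ((Δ 0 : Jr) : B1Eq324BenfattoLemma.Site d) ∈ R) :=
    fun Δ hΔ => Finset.mem_filter.2 ⟨Finset.mem_univ _, hin _ hp Δ hΔ 0⟩
  have h2 : ∑ Δ ∈ cls (p' + 1), Real.exp (-(c * connLength fun i => (Δ i : B1Eq324BenfattoLemma.Site d))) ≤
      (R.card : ℝ) * K ^ p' := by
    refine (Finset.sum_le_sum_of_subset_of_nonneg hsub fun Δ _ _ => (Real.exp_pos _).le).trans ?_
    refine (sum_exp_anchored_le (J := Jr) hc p' R).trans ?_
    have hK0 : 0 ≤ K ^ p' := pow_nonneg (pow_nonneg (mul_nonneg (div_nonneg zero_le_two ?_) (Real.exp_pos _).le) _) _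
    · exact mul_le_mul_of_nonneg_right (by exact_mod_cast card_filter_coe_mem_le (J := Jr) R) hK0
    · rw [sub_nonneg, Real.exp_le_one_iff, neg_nonpos]; positivity
  calc ∑ Δ ∈ cls (p' + 1), ∑ n ∈ admissible (p' + 1) D, w (p' + 1) Δ n
      ≤ ((admissible (p' + 1) D).card : ℝ) * A' *
          ∑ Δ ∈ cls (p' + 1), Real.exp (-(c * connLength fun i => (Δ i : B1Eq324BenfattoLemma.Site d))) := by
        refine h1.trans (le_of_eq ?_)
        rw [Finset.mul_sum]
        exact Finset.sum_congr rfl fun Δ _ => by ring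
    _ ≤ ((admissible (p' + 1) D).card : ℝ) * A' * ((R.card : ℝ) * K ^ p') :=
        mul_le_mul_of_nonneg_left h2 (mul_nonneg (Nat.cast_nonneg _) hA')
    _ = A' * R.card * (((admissible (p' + 1) D).card : ℝ) * K ^ p') := by ring

/-- **THE MASS OF A SLOT**: for a tuple class in the region `R` and coefficients `|A^n_Δ| ≤ A` on the range of (4.5),
`𝓜 = Σ_{p∈Icc 1 s}Σ_{Δ∈cls p}Σ_n |A^n_Δ|·e^{−(ϰ/2)d(Δ)} ≤ A·|R|·Σ_p |admissible p D|·K(ϰ/(2p), d)^{p−1}` — print's `s₂b^{D+2d}A` without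
the field factor `b^D` (`|R| ≤ |□| = b^{2d}`). [cite: BenfattoEtAl1978, (5.29) p.158] -/
theorem mass_le_card_mul (hϰ : 0 < ϰ) {A : ℝ} (hA0 : 0 ≤ A)
    (hA : ∀ p ∈ Finset.Icc 1 s, ∀ (Δ : Fin p → B1Eq324BenfattoLemma.Site d), (∀ i, Δ i ∈ Jr) →
      ∀ n ∈ admissible p D, |a p Δ n| ≤ A)
    (cls : (p : ℕ) → Finset (Fin p → Jr)) (R : Finset (B1Eq324BenfattoLemma.Site d))
    (hin : ∀ p ∈ Finset.Icc 1 s, ∀ Δ ∈ cls p, ∀ i, ((Δ i : Jr) : B1Eq324BenfattoLemma.Site d) ∈ R) :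
    ∑ p ∈ Finset.Icc 1 s, ∑ Δ ∈ cls p, ∑ n ∈ admissible p D,
        |a p (fun i => (Δ i : B1Eq324BenfattoLemma.Site d)) n| *
          Real.exp (-(ϰ / 2) * connLength fun i => (Δ i : B1Eq324BenfattoLemma.Site d)) ≤
      A * R.card * ∑ p ∈ Finset.Icc 1 s, ((admissible p D).card : ℝ) *
        ((2 / (1 - Real.exp (-(ϰ / 2 / (p : ℕ) / Real.sqrt d))) * Real.exp (ϰ / 2 / (p : ℕ) / Real.sqrt d)) ^ d) ^ (p - 1) := by
  refine classSum_le_card_mul (half_pos hϰ) hA0 cls R hin _ fun p hp Δ _ n hn => ?_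
  rw [show -(ϰ / 2) * connLength (fun i => (Δ i : B1Eq324BenfattoLemma.Site d)) =
    -(ϰ / 2 * connLength fun i => (Δ i : B1Eq324BenfattoLemma.Site d)) by ring]
  exact mul_le_mul_of_nonneg_right (hA p hp _ (fun i => (Δ i).2) n hn) (Real.exp_pos _).le

/-- **THE WEIGHTED MASS OF A SLOT** (the `𝓜̃` of `…TupleClusters` §3): at the residual rate `ϰ/2 − (δ/2)D²√d > 0`,
`𝓜̃ = Σ|A^n_Δ|e^{−(ϰ/2)d(Δ)}·e^{(δ/2)D²(√d·d(Δ)+d)} ≤ A·e^{(δ/2)D²d}·|R|·Σ_p |admissible p D|·K((ϰ − δD²√d)/(2p), d)^{p−1}`.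
[cite: BenfattoEtAl1978, (5.29) p.158 and Appendix D p.166] -/
theorem weightedMass_le_card_mul {δ : ℝ} (hres : 0 < ϰ / 2 - δ / 2 * ((D : ℝ) ^ 2 * Real.sqrt d)) {A : ℝ} (hA0 : 0 ≤ A)
    (hA : ∀ p ∈ Finset.Icc 1 s, ∀ (Δ : Fin p → B1Eq324BenfattoLemma.Site d), (∀ i, Δ i ∈ Jr) →
      ∀ n ∈ admissible p D, |a p Δ n| ≤ A)
    (cls : (p : ℕ) → Finset (Fin p → Jr)) (R : Finset (B1Eq324BenfattoLemma.Site d))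
    (hin : ∀ p ∈ Finset.Icc 1 s, ∀ Δ ∈ cls p, ∀ i, ((Δ i : Jr) : B1Eq324BenfattoLemma.Site d) ∈ R) :
    ∑ p ∈ Finset.Icc 1 s, ∑ Δ ∈ cls p, ∑ n ∈ admissible p D,
        |a p (fun i => (Δ i : B1Eq324BenfattoLemma.Site d)) n| *
          Real.exp (-(ϰ / 2) * connLength fun i => (Δ i : B1Eq324BenfattoLemma.Site d)) *
          Real.exp (δ / 2 * ((D : ℝ) ^ 2 * (Real.sqrt d * connLength (fun i => (Δ i : B1Eq324BenfattoLemma.Site d)) + d))) ≤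
      A * Real.exp (δ / 2 * ((D : ℝ) ^ 2 * d)) * R.card * ∑ p ∈ Finset.Icc 1 s, ((admissible p D).card : ℝ) *
        ((2 / (1 - Real.exp (-((ϰ / 2 - δ / 2 * ((D : ℝ) ^ 2 * Real.sqrt d)) / (p : ℕ) / Real.sqrt d))) *
          Real.exp ((ϰ / 2 - δ / 2 * ((D : ℝ) ^ 2 * Real.sqrt d)) / (p : ℕ) / Real.sqrt d)) ^ d) ^ (p - 1) := by
  refine classSum_le_card_mul hres (mul_nonneg hA0 (Real.exp_pos _).le) cls R hin _ fun p hp Δ _ n hn => ?_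
  set ℓ := connLength (fun i => (Δ i : B1Eq324BenfattoLemma.Site d)) with hℓ
  have hexp : Real.exp (-(ϰ / 2) * ℓ) * Real.exp (δ / 2 * ((D : ℝ) ^ 2 * (Real.sqrt d * ℓ + d))) =
      Real.exp (δ / 2 * ((D : ℝ) ^ 2 * d)) * Real.exp (-((ϰ / 2 - δ / 2 * ((D : ℝ) ^ 2 * Real.sqrt d)) * ℓ)) := by
    rw [← Real.exp_add, ← Real.exp_add]
    congr 1
    ring
  calc |a p (fun i => (Δ i : B1Eq324BenfattoLemma.Site d)) n| * Real.exp (-(ϰ / 2) * ℓ) *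
        Real.exp (δ / 2 * ((D : ℝ) ^ 2 * (Real.sqrt d * ℓ + d)))
      = |a p (fun i => (Δ i : B1Eq324BenfattoLemma.Site d)) n| *
          (Real.exp (δ / 2 * ((D : ℝ) ^ 2 * d)) * Real.exp (-((ϰ / 2 - δ / 2 * ((D : ℝ) ^ 2 * Real.sqrt d)) * ℓ))) := by
        rw [mul_assoc, hexp]
    _ ≤ A * (Real.exp (δ / 2 * ((D : ℝ) ^ 2 * d)) * Real.exp (-((ϰ / 2 - δ / 2 * ((D : ℝ) ^ 2 * Real.sqrt d)) * ℓ))) :=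
        mul_le_mul_of_nonneg_right (hA p hp _ (fun i => (Δ i).2) n hn) (by positivity)
    _ = A * Real.exp (δ / 2 * ((D : ℝ) ^ 2 * d)) * Real.exp (-((ϰ / 2 - δ / 2 * ((D : ℝ) ^ 2 * Real.sqrt d)) * ℓ)) := by
        ring

end Literature.MathematicalPhysics.QuantumFieldTheory.Balaban1983to89.B1Eq324BenfattoSect5SlotMasses
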